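import Summits.QuantumFields.YangMills.Theorems.BalabanUVNodesN21ShellSplitOfRecord13CoPHChart
import Summits.QuantumFields.BalabanUV.T4Continuum.Support.ShellMeasureRootCompositionLevelZero

/-!
# N21 (NE7c) · JUNCTION №3 KEYED AT THE RECORD: dag-n21-d's END `shellWeightBound_crOfRecord₁₃At_shellSplit_of_blockFibreAC` from
# PER-FIBRE CHART DATA — window factorisation, density presentation, reading identity and (M1) FOR THE CUT CHART LAW on the
# exponential `SU(N)` block chart — with NO two-ratio dictionary (the chart identity `chart_suN ∘ haar_restrict_expBallSU_le` instead)

Track A of `YM-PLAN.md` (cell `pub-ymgap`, HUMAN RULING D-0062 ∕ D-0149 width seats), node **N21**; WIDTH SEAT `pub-ymgap-dag-n21-w2`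
(gen 2), file 11 = dag-lead WIDTH-209 N21 piece 4 («the FINAL KNIT at the record from per-fibre charts») CUT TO THE STABLE SOCKET.  THEOREMS
ONLY: 0 `def`, 0 `sorry`; COUNT-NEUTRAL; `--kind proof --supports stmt-QuantumFields-20544 --as helper`.  Imports my gen-0 junction №3
`…N21ShellSplitOfRecord13CoPHChart` (p600281 → `…StatDilation` p598391 → dag-n21-d's FILE 6 `…Stat` p597562 ★★★★, n20-d's readings) and pub-balaban's
`Support/ShellMeasureRootCompositionLevelZero` (for `slotAntiConcentration_congr_offNull` BY NAME: a law carried by the window reads the statistic on the window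
only — the content of dag-n21-w1's `slotAntiConcentration_congr_support`, p604008).  NO Theses import.  Restates nothing; cites by name.

WHY.  dag-n21-w1 g2's ENDs on the exponential `SU(N)` block chart (file 10 `fibreAC_of_sect1Letters_expChartSU`: the [LF-II]-§1 ROWS ⇒ the
per-fibre (M1); INTENT-11: the Haar Jacobian moved into the exponent) all finish in the SAME three steps — an a.e. DENSITY PRESENTATION of the
windowed, Jacobian-weighted chart density as a cut density `A.indicator f`, the READING IDENTITY on the window, and my gen-0 junction №3.  This file
keys exactly that socket at n20-d's reading of record: the knit is written ONCE and survives every re-cut of the letter list upstream (the rows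
stay displayed in the producers' theorems).  38t′ (dag-n21-e `shellWeightBound_crOfRecord₁₃At_shellSplit_of_fibreCharts`) is the sibling with a
two-ratio dictionary `M₁, M₂`; here the exponential chart identity replaces the dictionary, so the constant of record stays `D_K`.

WHAT IS PROVED ([bookkeeping]; one application each).
* §1 `fibreAC_of_chartLawAC` — ONE block fibre law of ANY truncated law `blockFibreLawOfDatum₉ … t a b x` and ANY measurable block statistic `v`:
  `hlaw` (window factorisation about a centre `c`, radius `0 ≤ S ≤ π`, measurable weight `R`) + `hread : ∀ z ∈ closedBall 0 S, v (expFibreChartSU b c z) = U z`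
  + `hdens : chartWeightSU b S (expJacWeightSU κ_N) · R ∘ expFibreChartSU b c =ᵐ[vol] A.indicator f` + `SlotAntiConcentration ((vol.withDensity f).restrict A) U θ ρ D`
  ⟹ `SlotAntiConcentration (blockFibreLawOfDatum₉ … t a b x) v θ ρ D` (pub-balaban `slotAntiConcentration_of_chart ∘ chart_suN ∘ haar_restrict_expBallSU_le`,
  `slotAntiConcentration_congr_offNull`); `termFibreAC_of_chartLawAC` — the same at dag-n21-d's per-TERM law `termFibreLawOfDatum₉ … t s b x`.
* §2 ★★ `shellWeightBound_crOfRecord₁₃At_shellSplit_of_chartLaws` — THE KNIT: dag-n21-d's ★★★★ with `hfibA ∕ hfibB` replaced, per (run, K, `|t| ≤ 1`, top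
  cube `a`, exterior `x`), by an ∃-PACKAGE of chart data `(S, c, R, U, A, f, D)` carrying `0 ≤ S ≤ π`, `Measurable R`, `hlaw`, `MeasurableSet A`, `hread` for the
  block reading of the cube statistic of record (exterior `1`: dag-n21-d's locality), `hdens`, (M1) for the cut chart law below `ε_k` at width `ρ_K` with
  constant `D`, and `D ≤ D_K`; every other binder (`hsel`, (H-U), (H-ζ), `0 ≤ ζ`, width signs, `0 ≤ D_K`, `Σ_K D_K ρ_K < ∞`) VERBATIM.
* §3 `shellWeightBound_crOfRecord₁₃VAt_shellSplit_of_chartLaws` — the V edition (`Iff.rfl` transfer p598391 `shellWeightBound_crOfRecord₁₃VAt_iff_crOfRecord₁₃At`).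

HONEST FRAMING.  The window factorisation of the dressed fibre density, the density presentation (for dag-n21-w1's producers: convexity of the
(1.2) exponent on the chart, the printed rows' identification with the N21 slot's block action), the reading identity and the chart-law (M1) are
HYPOTHESES per fibre — located letters (small-field windows ∕ [LF-II] §1 ∕ NODE O's term object), inhabited for no family here; `hsel`, (H-U),
(H-ζ), `0 ≤ ζ`, widths, `D_K` HYPOTHESES; `jcut` displayed; K0⁷ OPEN; nothing of Bałaban's asserted; NE7c NOT PRINTED ∕ NOT proved; **N21 NOT
discharged**; K3⁷ NOT claimed; counts UNMOVED (typed 28∕28 · discharged 5∕27); one finite four-torus programme at fixed `ε` — NOT ℝ⁴, NOT infinite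
volume, NOT OS, NOT a mass gap, NOT Clay.  No decl below carries a cite tag.
-/

set_option autoImplicit false

open scoped BigOperators ENNReal
open Finset MeasureTheory Function Metric

namespace Summit.QuantumFields.YangMills.Theorems.N21ChartJunctionKeyed

open Literature.MathematicalPhysics.QuantumFieldTheory.Balaban1983to89
open Literature.MathematicalPhysics.QuantumFieldTheory.Balaban1983to89.T4Continuum
open Literature.MathematicalPhysics.QuantumFieldTheory.Balaban1983to89.Node00 hiding dimSU
open T4ShellMeasure (SlotAntiConcentration)
open T4ShellMeasureDet (blockLaw slotAntiConcentration_of_chart)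
open T4ShellMeasureFibre (slotAntiConcentration_mono)
open T4IndicatorShell (ShellWeightBound)
open YMDAG.UVSplit (crOfRecord₁₃At crOfRecord₁₃VAt ShellSplit₁₃CoPH runA₁₃ runB₁₃ histA₁₃ histB₁₃)
open N21ShellSplitOfRecord13CoPH (WidthLetter₁₃CoPH shellSplitOfRecord₁₃At cubeStat inputBlock blockReading blockFibreLawOfDatum₉
  termFibreLawOfDatum₉ measurable_cubeStat shellWeightBound_crOfRecord₁₃At_shellSplit_of_blockFibreAC)
open N21DilationRoadAtRecord13CoPH (measurable_blockReading shellWeightBound_crOfRecord₁₃VAt_iff_crOfRecord₁₃At)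
open Summit.QuantumFields.BalabanUV.T4Continuum.ShellMeasureRootCompositionLevelZero (slotAntiConcentration_congr_offNull)
open Summit.QuantumFields.BalabanUV.T4Continuum.ShellMeasureExpChartSUN
  (SUN BlockChartSU expFibreChartSU measurable_expFibreChartSU chartWeightSU measurable_chartWeightSU)
open Summit.QuantumFields.BalabanUV.T4Continuum.ShellMeasureScalingSUN (windowSU measurable_windowSU chart_suN)
open Summit.QuantumFields.BalabanUV.T4Continuum.ShellMeasureExpJacobianSUN (expJacWeightSU measurable_expJacWeightSU)
open Summit.QuantumFields.BalabanUV.T4Continuum.ShellMeasureExpHaarAreaSUN (kappaSU)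
open Summit.QuantumFields.BalabanUV.T4Continuum.ShellMeasureExpHaarClosedBallSUN (haar_restrict_expBallSU_le)

/-! ## §1 One fibre: the cut chart law's (M1) through the window, the density presentation and the reading identity -/

section OneFibre

variable (F : T4Family) (N : ℕ) [NeZero N] (ϑ : Stage9Params F N) (Dt : FiniteEpsData F (SU N)) (g₀ : ℕ → ℝ)
  (os : List (ULoop F)) (p : B12.RunParams) (g : ℕ → ℝ) (k : ℕ)

/-- **(M1) FOR ONE BLOCK FIBRE LAW OF A TRUNCATED LAW FROM (M1) FOR A CUT CHART LAW.**  One fibre (source `t`, top cube `a`, bond block `b`,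
exterior `x`) and ANY measurable block statistic `v`: IF the fibre law factors through the exponential windows of radius `S ∈ [0, π]` about a chart
centre `c` with a measurable weight `R` (`hlaw`), the windowed Jacobian-weighted chart density is presented a.e. as a cut density `A.indicator f`
(`hdens`), the statistic reads `U` in the chart ON THE WINDOW (`hread`), and the cut chart law `(vol.withDensity f)|_A` satisfies (M1) along `U`,
THEN the fibre law satisfies (M1) along `v`, SAME `θ ρ D` (`slotAntiConcentration_congr_offNull`, `slotAntiConcentration_of_chart` at
`chart_suN ∘ haar_restrict_expBallSU_le` BY NAME). [bookkeeping] -/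
theorem fibreAC_of_chartLawAC (t : ℝ)
    (a : ↥(cubeIndices (F.P p.K) (cubeSide (F.P p.K).L ϑ.ν.M₂ (RkOfRecord (F.P p.K).L ϑ.ν.r (g k)) k)))
    (b : Finset (PBond (F.P p.K) k)) (x : GaugeField (F.P p.K) k (SU N))
    {S : ℝ} (hS : 0 ≤ S) (hSπ : S ≤ Real.pi) (c : GaugeField (F.P p.K) k (SU N))
    {R : (↥b → SU N) → ℝ≥0∞} (hR : Measurable R)
    (hlaw : blockFibreLawOfDatum₉ F N ϑ Dt g₀ os p g k t a b x = (blockLaw b).withDensity fun y => windowSU b c S y * R y)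
    {v : (↥b → SU N) → ℝ} (hv : Measurable v)
    {U : BlockChartSU N b → ℝ} {A : Set (BlockChartSU N b)} (hA : MeasurableSet A) {f : BlockChartSU N b → ℝ≥0∞}
    (hread : ∀ z ∈ closedBall (0 : BlockChartSU N b) S, v (expFibreChartSU b c z) = U z)
    (hdens : (fun z : BlockChartSU N b => chartWeightSU b S (expJacWeightSU (kappaSU N)) z * R (expFibreChartSU b c z))
      =ᵐ[volume] A.indicator f)
    {θ ρ D : ℝ} (hchart : SlotAntiConcentration (((volume : Measure (BlockChartSU N b)).withDensity f).restrict A) U θ ρ D) :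
    SlotAntiConcentration (blockFibreLawOfDatum₉ F N ϑ Dt g₀ os p g k t a b x) v θ ρ D := by
  have h1 : SlotAntiConcentration ((volume : Measure (BlockChartSU N b)).withDensity fun z =>
      chartWeightSU b S (expJacWeightSU (kappaSU N)) z * R (expFibreChartSU b c z)) U θ ρ D := by
    rw [restrict_withDensity hA, ← withDensity_indicator hA, ← withDensity_congr_ae hdens] at hchart
    exact hchart
  have hform : (fun z : BlockChartSU N b => chartWeightSU b S (expJacWeightSU (kappaSU N)) z * R (expFibreChartSU b c z)) =
      (closedBall (0 : BlockChartSU N b) S).indicator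
        fun z => (∏ i, expJacWeightSU (kappaSU N) (z i)) * R (expFibreChartSU b c z) := by
    funext z
    show (closedBall (0 : BlockChartSU N b) S).indicator (fun z' => ∏ i, expJacWeightSU (kappaSU N) (z' i)) z *
        R (expFibreChartSU b c z) = _
    exact (Set.indicator_mul_left (closedBall (0 : BlockChartSU N b) S)
      (fun z' => ∏ i, expJacWeightSU (kappaSU N) (z' i)) fun z' => R (expFibreChartSU b c z')).symm
  rw [hform] at h1
  have h2 : SlotAntiConcentration ((volume : Measure (BlockChartSU N b)).withDensity
      ((closedBall (0 : BlockChartSU N b) S).indicator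
        fun z => (∏ i, expJacWeightSU (kappaSU N) (z i)) * R (expFibreChartSU b c z)))
      (v ∘ expFibreChartSU b c) θ ρ D :=
    slotAntiConcentration_congr_offNull volume measurableSet_closedBall (fun z hz => Set.indicator_of_notMem hz _)
      (fun z hz => hread z hz) h1
  rw [← hform] at h2
  rw [hlaw]
  exact slotAntiConcentration_of_chart (blockLaw b) volume (measurable_expFibreChartSU b c)
    (measurable_chartWeightSU b S (measurable_expJacWeightSU (kappaSU N))) (measurable_windowSU b c S)
    (chart_suN b c hS (measurable_expJacWeightSU (kappaSU N)) (haar_restrict_expBallSU_le hSπ)) hR hv h2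

/-- **THE SAME AT ONE TERM's FIBRE LAW** `termFibreLawOfDatum₉ … t s b x` (dag-n21-d's Defs v1.2: ONE (2.18) history's dressed integrand with the
exterior frozen — where the window factorisation about that history's background is natural). [bookkeeping] -/
theorem termFibreAC_of_chartLawAC (t : ℝ) (s : SeqOfRecord F ϑ.ν ϑ.τ9.M g p.K k)
    (b : Finset (PBond (F.P p.K) k)) (x : GaugeField (F.P p.K) k (SU N))
    {S : ℝ} (hS : 0 ≤ S) (hSπ : S ≤ Real.pi) (c : GaugeField (F.P p.K) k (SU N))
    {R : (↥b → SU N) → ℝ≥0∞} (hR : Measurable R)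
    (hlaw : termFibreLawOfDatum₉ F N ϑ Dt g₀ os p g k t s b x = (blockLaw b).withDensity fun y => windowSU b c S y * R y)
    {v : (↥b → SU N) → ℝ} (hv : Measurable v)
    {U : BlockChartSU N b → ℝ} {A : Set (BlockChartSU N b)} (hA : MeasurableSet A) {f : BlockChartSU N b → ℝ≥0∞}
    (hread : ∀ z ∈ closedBall (0 : BlockChartSU N b) S, v (expFibreChartSU b c z) = U z)
    (hdens : (fun z : BlockChartSU N b => chartWeightSU b S (expJacWeightSU (kappaSU N)) z * R (expFibreChartSU b c z))
      =ᵐ[volume] A.indicator f)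
    {θ ρ D : ℝ} (hchart : SlotAntiConcentration (((volume : Measure (BlockChartSU N b)).withDensity f).restrict A) U θ ρ D) :
    SlotAntiConcentration (termFibreLawOfDatum₉ F N ϑ Dt g₀ os p g k t s b x) v θ ρ D := by
  have h1 : SlotAntiConcentration ((volume : Measure (BlockChartSU N b)).withDensity fun z =>
      chartWeightSU b S (expJacWeightSU (kappaSU N)) z * R (expFibreChartSU b c z)) U θ ρ D := by
    rw [restrict_withDensity hA, ← withDensity_indicator hA, ← withDensity_congr_ae hdens] at hchart
    exact hchart
  have hform : (fun z : BlockChartSU N b => chartWeightSU b S (expJacWeightSU (kappaSU N)) z * R (expFibreChartSU b c z)) =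
      (closedBall (0 : BlockChartSU N b) S).indicator
        fun z => (∏ i, expJacWeightSU (kappaSU N) (z i)) * R (expFibreChartSU b c z) := by
    funext z
    show (closedBall (0 : BlockChartSU N b) S).indicator (fun z' => ∏ i, expJacWeightSU (kappaSU N) (z' i)) z *
        R (expFibreChartSU b c z) = _
    exact (Set.indicator_mul_left (closedBall (0 : BlockChartSU N b) S)
      (fun z' => ∏ i, expJacWeightSU (kappaSU N) (z' i)) fun z' => R (expFibreChartSU b c z')).symm
  rw [hform] at h1
  have h2 : SlotAntiConcentration ((volume : Measure (BlockChartSU N b)).withDensity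
      ((closedBall (0 : BlockChartSU N b) S).indicator
        fun z => (∏ i, expJacWeightSU (kappaSU N) (z i)) * R (expFibreChartSU b c z)))
      (v ∘ expFibreChartSU b c) θ ρ D :=
    slotAntiConcentration_congr_offNull volume measurableSet_closedBall (fun z hz => Set.indicator_of_notMem hz _)
      (fun z hz => hread z hz) h1
  rw [← hform] at h2
  rw [hlaw]
  exact slotAntiConcentration_of_chart (blockLaw b) volume (measurable_expFibreChartSU b c)
    (measurable_chartWeightSU b S (measurable_expJacWeightSU (kappaSU N))) (measurable_windowSU b c S)
    (chart_suN b c hS (measurable_expJacWeightSU (kappaSU N)) (haar_restrict_expBallSU_le hSπ)) hR hv h2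

end OneFibre

/-! ## §2 The keyed END at the reading of record from per-fibre chart data -/

section AtRecord

variable {F : T4Family} {N : ℕ} [NeZero N]

/-- ★★ **dag-n21-d's END AT THE READING OF RECORD FROM PER-FIBRE CHART DATA.**  `ShellWeightBound` at `crOfRecord₁₃At K₀ jcut (shellSplitOfRecord₁₃At N K₀ ρA ρB)`
(carriers + canonical `Wsh`) on the live-selector line FROM: n20-d's extraction rows (`hsel`, (H-U), (H-ζ), `0 ≤ ζ`), the width letters' signs, constants `0 ≤ D_K`
with `Σ_K D_K ρ_K < ∞` per run, and — replacing dag-n21-d's one displayed estimate — per (run, K, `|t| ≤ 1`, top cube `a`, exterior field `x`) an ∃-package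
of CHART DATA `(S, c, R, U, A, f, D)`: a window radius `S ∈ [0, π]` and centre `c`, a measurable weight `R` with the WINDOW FACTORISATION of the block fibre law of
record, a measurable cut `A` and density `f` PRESENTING the windowed Jacobian-weighted chart density a.e., a chart statistic `U` READING the block reading of the
cube statistic of record on the window, (M1) for the cut chart law `(vol.withDensity f)|_A` along `U` below `ε_k` at width `ρ_K` with constant `D ≤ D_K`
(§1 per fibre, `slotAntiConcentration_mono`, dag-n21-d's ★★★★ BY NAME). [bookkeeping] -/
theorem shellWeightBound_crOfRecord₁₃At_shellSplit_of_chartLaws (K₀ : ℕ) (jcut : ℕ → ℕ) (ρA ρB : WidthLetter₁₃CoPH N) (θ : Stage13HParams F N)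
    (hP : θ.Provisos₁₃CoPH F N) (g₀ : ℕ → ℝ) (os : List (ULoop F)) (E : B12.RunParams → ℝ)
    (hsel : θ.ppSel = ppSelLiveOfRecord F N θ.ν θ.τ9 E (wOfRecord₉ F N θ.toStage9Params))
    (hU : LocalBgMeasurable F N θ.ν) (hζm : ZetaMeasurable F N θ.ζ) (hζ0 : ∀ p g k s Pl Ql RS U V', 0 ≤ θ.ζ p g k s Pl Ql RS U V')
    {DA DB : ℕ → ℝ} (hρA : ∀ K, 0 ≤ ρA F θ hP g₀ os K) (hDA : ∀ K, 0 ≤ DA K) (hρB : ∀ K, 0 ≤ ρB F θ hP g₀ os K) (hDB : ∀ K, 0 ≤ DB K)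
    (hsA : Summable (fun K => DA K * ρA F θ hP g₀ os K)) (hsB : Summable (fun K => DB K * ρB F θ hP g₀ os K))
    (hA : ∀ (K : ℕ) (t : ℝ), |t| ≤ 1 →
      ∀ (a : ↥(cubeIndices (F.P (K₀ + K)) (cubeSide (F.P (K₀ + K)).L θ.ν.M₂ (RkOfRecord (F.P (K₀ + K)).L θ.ν.r (histA₁₃ θ K₀ g₀ K (K₀ + K))) (K₀ + K))))
        (x : GaugeField (F.P (K₀ + K)) (K₀ + K) (SU N)),
        ∃ (S : ℝ) (c : GaugeField (F.P (K₀ + K)) (K₀ + K) (SU N)) (R : (↥(inputBlock F θ.ν (histA₁₃ θ K₀ g₀ K) a) → SU N) → ℝ≥0∞)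
          (U : BlockChartSU N (inputBlock F θ.ν (histA₁₃ θ K₀ g₀ K) a) → ℝ) (A : Set (BlockChartSU N (inputBlock F θ.ν (histA₁₃ θ K₀ g₀ K) a)))
          (f : BlockChartSU N (inputBlock F θ.ν (histA₁₃ θ K₀ g₀ K) a) → ℝ≥0∞) (D : ℝ),
          0 ≤ S ∧ S ≤ Real.pi ∧ Measurable R ∧
          blockFibreLawOfDatum₉ F N θ.toStage9Params (datumOfRecord₁₃CoPH F N θ hP) g₀ os (runA₁₃ F K₀ g₀ K) (histA₁₃ θ K₀ g₀ K) (K₀ + K) t a (inputBlock F θ.ν (histA₁₃ θ K₀ g₀ K) a) x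
            = (blockLaw (inputBlock F θ.ν (histA₁₃ θ K₀ g₀ K) a)).withDensity (fun y => windowSU (inputBlock F θ.ν (histA₁₃ θ K₀ g₀ K) a) c S y * R y) ∧
          MeasurableSet A ∧
          (∀ z ∈ closedBall (0 : BlockChartSU N (inputBlock F θ.ν (histA₁₃ θ K₀ g₀ K) a)) S,
            blockReading N (cubeStat F N θ.ν (histA₁₃ θ K₀ g₀ K) (Kc := K₀ + K) (k := K₀ + K) a) (inputBlock F θ.ν (histA₁₃ θ K₀ g₀ K) a) (fun _ => 1) (expFibreChartSU (inputBlock F θ.ν (histA₁₃ θ K₀ g₀ K) a) c z) = U z) ∧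
          ((fun z : BlockChartSU N (inputBlock F θ.ν (histA₁₃ θ K₀ g₀ K) a) =>
              chartWeightSU (inputBlock F θ.ν (histA₁₃ θ K₀ g₀ K) a) S (expJacWeightSU (kappaSU N)) z * R (expFibreChartSU (inputBlock F θ.ν (histA₁₃ θ K₀ g₀ K) a) c z))
            =ᵐ[volume] A.indicator f) ∧
          SlotAntiConcentration (((volume : Measure (BlockChartSU N (inputBlock F θ.ν (histA₁₃ θ K₀ g₀ K) a))).withDensity f).restrict A) U
            (epsOfRecord θ.ν (histA₁₃ θ K₀ g₀ K) (K₀ + K)) (ρA F θ hP g₀ os K) D ∧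
          D ≤ DA K)
    (hB : ∀ (K : ℕ) (t : ℝ), |t| ≤ 1 →
      ∀ (a : ↥(cubeIndices (F.P (K₀ + K + 1)) (cubeSide (F.P (K₀ + K + 1)).L θ.ν.M₂ (RkOfRecord (F.P (K₀ + K + 1)).L θ.ν.r (histB₁₃ θ K₀ g₀ K (K₀ + K + 1))) (K₀ + K + 1))))
        (x : GaugeField (F.P (K₀ + K + 1)) (K₀ + K + 1) (SU N)),
        ∃ (S : ℝ) (c : GaugeField (F.P (K₀ + K + 1)) (K₀ + K + 1) (SU N)) (R : (↥(inputBlock F θ.ν (histB₁₃ θ K₀ g₀ K) a) → SU N) → ℝ≥0∞)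
          (U : BlockChartSU N (inputBlock F θ.ν (histB₁₃ θ K₀ g₀ K) a) → ℝ) (A : Set (BlockChartSU N (inputBlock F θ.ν (histB₁₃ θ K₀ g₀ K) a)))
          (f : BlockChartSU N (inputBlock F θ.ν (histB₁₃ θ K₀ g₀ K) a) → ℝ≥0∞) (D : ℝ),
          0 ≤ S ∧ S ≤ Real.pi ∧ Measurable R ∧
          blockFibreLawOfDatum₉ F N θ.toStage9Params (datumOfRecord₁₃CoPH F N θ hP) g₀ os (runB₁₃ F K₀ g₀ K) (histB₁₃ θ K₀ g₀ K) (K₀ + K + 1) t a (inputBlock F θ.ν (histB₁₃ θ K₀ g₀ K) a) x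
            = (blockLaw (inputBlock F θ.ν (histB₁₃ θ K₀ g₀ K) a)).withDensity (fun y => windowSU (inputBlock F θ.ν (histB₁₃ θ K₀ g₀ K) a) c S y * R y) ∧
          MeasurableSet A ∧
          (∀ z ∈ closedBall (0 : BlockChartSU N (inputBlock F θ.ν (histB₁₃ θ K₀ g₀ K) a)) S,
            blockReading N (cubeStat F N θ.ν (histB₁₃ θ K₀ g₀ K) (Kc := K₀ + K + 1) (k := K₀ + K + 1) a) (inputBlock F θ.ν (histB₁₃ θ K₀ g₀ K) a) (fun _ => 1) (expFibreChartSU (inputBlock F θ.ν (histB₁₃ θ K₀ g₀ K) a) c z) = U z) ∧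
          ((fun z : BlockChartSU N (inputBlock F θ.ν (histB₁₃ θ K₀ g₀ K) a) =>
              chartWeightSU (inputBlock F θ.ν (histB₁₃ θ K₀ g₀ K) a) S (expJacWeightSU (kappaSU N)) z * R (expFibreChartSU (inputBlock F θ.ν (histB₁₃ θ K₀ g₀ K) a) c z))
            =ᵐ[volume] A.indicator f) ∧
          SlotAntiConcentration (((volume : Measure (BlockChartSU N (inputBlock F θ.ν (histB₁₃ θ K₀ g₀ K) a))).withDensity f).restrict A) U
            (epsOfRecord θ.ν (histB₁₃ θ K₀ g₀ K) (K₀ + K + 1)) (ρB F θ hP g₀ os K) D ∧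
          D ≤ DB K)
    :
    ShellWeightBound (crOfRecord₁₃At K₀ jcut (shellSplitOfRecord₁₃At N K₀ ρA ρB) F θ hP g₀ os).l₀
      (crOfRecord₁₃At K₀ jcut (shellSplitOfRecord₁₃At N K₀ ρA ρB) F θ hP g₀ os).T (crOfRecord₁₃At K₀ jcut (shellSplitOfRecord₁₃At N K₀ ρA ρB) F θ hP g₀ os).A
      (crOfRecord₁₃At K₀ jcut (shellSplitOfRecord₁₃At N K₀ ρA ρB) F θ hP g₀ os).B (crOfRecord₁₃At K₀ jcut (shellSplitOfRecord₁₃At N K₀ ρA ρB) F θ hP g₀ os).shA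
      (crOfRecord₁₃At K₀ jcut (shellSplitOfRecord₁₃At N K₀ ρA ρB) F θ hP g₀ os).shB (crOfRecord₁₃At K₀ jcut (shellSplitOfRecord₁₃At N K₀ ρA ρB) F θ hP g₀ os).Wsh := by
  refine shellWeightBound_crOfRecord₁₃At_shellSplit_of_blockFibreAC K₀ jcut ρA ρB θ hP g₀ os E hsel hU hζm hζ0 hρA hDA hρB hDB hsA hsB
    (fun K t ht a x => ?_) (fun K t ht a x => ?_)
  · obtain ⟨S, c, R, U, A, f, D, hS, hSπ, hR, hlaw, hAm, hread, hdens, hchart, hD⟩ := hA K t ht a x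
    exact slotAntiConcentration_mono (hρA K) hD
      (fibreAC_of_chartLawAC F N θ.toStage9Params (datumOfRecord₁₃CoPH F N θ hP) g₀ os (runA₁₃ F K₀ g₀ K) (histA₁₃ θ K₀ g₀ K) (K₀ + K) t a
        (inputBlock F θ.ν (histA₁₃ θ K₀ g₀ K) a) x hS hSπ c hR hlaw
        (measurable_blockReading (measurable_cubeStat F N θ.ν (histA₁₃ θ K₀ g₀ K) (K₀ + K) (K₀ + K) hU a) _ _) hAm hread hdens hchart)
  · obtain ⟨S, c, R, U, A, f, D, hS, hSπ, hR, hlaw, hAm, hread, hdens, hchart, hD⟩ := hB K t ht a x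
    exact slotAntiConcentration_mono (hρB K) hD
      (fibreAC_of_chartLawAC F N θ.toStage9Params (datumOfRecord₁₃CoPH F N θ hP) g₀ os (runB₁₃ F K₀ g₀ K) (histB₁₃ θ K₀ g₀ K) (K₀ + K + 1) t a
        (inputBlock F θ.ν (histB₁₃ θ K₀ g₀ K) a) x hS hSπ c hR hlaw
        (measurable_blockReading (measurable_cubeStat F N θ.ν (histB₁₃ θ K₀ g₀ K) (K₀ + K + 1) (K₀ + K + 1) hU a) _ _) hAm hread hdens hchart)

/-! ## §3 The V edition (`vol := F.side ^ 4`): the shell face is volume-blind -/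

/-- The same knit AT THE PHYSICAL-VOLUME READING `crOfRecord₁₃VAt` (K3⁷'s pin; p598391 `shellWeightBound_crOfRecord₁₃VAt_iff_crOfRecord₁₃At` is `Iff.rfl`).
[bookkeeping] -/
theorem shellWeightBound_crOfRecord₁₃VAt_shellSplit_of_chartLaws (K₀ : ℕ) (jcut : ℕ → ℕ) (ρA ρB : WidthLetter₁₃CoPH N) (θ : Stage13HParams F N)
    (hP : θ.Provisos₁₃CoPH F N) (g₀ : ℕ → ℝ) (os : List (ULoop F)) (E : B12.RunParams → ℝ)
    (hsel : θ.ppSel = ppSelLiveOfRecord F N θ.ν θ.τ9 E (wOfRecord₉ F N θ.toStage9Params))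
    (hU : LocalBgMeasurable F N θ.ν) (hζm : ZetaMeasurable F N θ.ζ) (hζ0 : ∀ p g k s Pl Ql RS U V', 0 ≤ θ.ζ p g k s Pl Ql RS U V')
    {DA DB : ℕ → ℝ} (hρA : ∀ K, 0 ≤ ρA F θ hP g₀ os K) (hDA : ∀ K, 0 ≤ DA K) (hρB : ∀ K, 0 ≤ ρB F θ hP g₀ os K) (hDB : ∀ K, 0 ≤ DB K)
    (hsA : Summable (fun K => DA K * ρA F θ hP g₀ os K)) (hsB : Summable (fun K => DB K * ρB F θ hP g₀ os K))
    (hA : ∀ (K : ℕ) (t : ℝ), |t| ≤ 1 →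
      ∀ (a : ↥(cubeIndices (F.P (K₀ + K)) (cubeSide (F.P (K₀ + K)).L θ.ν.M₂ (RkOfRecord (F.P (K₀ + K)).L θ.ν.r (histA₁₃ θ K₀ g₀ K (K₀ + K))) (K₀ + K))))
        (x : GaugeField (F.P (K₀ + K)) (K₀ + K) (SU N)),
        ∃ (S : ℝ) (c : GaugeField (F.P (K₀ + K)) (K₀ + K) (SU N)) (R : (↥(inputBlock F θ.ν (histA₁₃ θ K₀ g₀ K) a) → SU N) → ℝ≥0∞)
          (U : BlockChartSU N (inputBlock F θ.ν (histA₁₃ θ K₀ g₀ K) a) → ℝ) (A : Set (BlockChartSU N (inputBlock F θ.ν (histA₁₃ θ K₀ g₀ K) a)))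
          (f : BlockChartSU N (inputBlock F θ.ν (histA₁₃ θ K₀ g₀ K) a) → ℝ≥0∞) (D : ℝ),
          0 ≤ S ∧ S ≤ Real.pi ∧ Measurable R ∧
          blockFibreLawOfDatum₉ F N θ.toStage9Params (datumOfRecord₁₃CoPH F N θ hP) g₀ os (runA₁₃ F K₀ g₀ K) (histA₁₃ θ K₀ g₀ K) (K₀ + K) t a (inputBlock F θ.ν (histA₁₃ θ K₀ g₀ K) a) x
            = (blockLaw (inputBlock F θ.ν (histA₁₃ θ K₀ g₀ K) a)).withDensity (fun y => windowSU (inputBlock F θ.ν (histA₁₃ θ K₀ g₀ K) a) c S y * R y) ∧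
          MeasurableSet A ∧
          (∀ z ∈ closedBall (0 : BlockChartSU N (inputBlock F θ.ν (histA₁₃ θ K₀ g₀ K) a)) S,
            blockReading N (cubeStat F N θ.ν (histA₁₃ θ K₀ g₀ K) (Kc := K₀ + K) (k := K₀ + K) a) (inputBlock F θ.ν (histA₁₃ θ K₀ g₀ K) a) (fun _ => 1) (expFibreChartSU (inputBlock F θ.ν (histA₁₃ θ K₀ g₀ K) a) c z) = U z) ∧
          ((fun z : BlockChartSU N (inputBlock F θ.ν (histA₁₃ θ K₀ g₀ K) a) =>
              chartWeightSU (inputBlock F θ.ν (histA₁₃ θ K₀ g₀ K) a) S (expJacWeightSU (kappaSU N)) z * R (expFibreChartSU (inputBlock F θ.ν (histA₁₃ θ K₀ g₀ K) a) c z))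
            =ᵐ[volume] A.indicator f) ∧
          SlotAntiConcentration (((volume : Measure (BlockChartSU N (inputBlock F θ.ν (histA₁₃ θ K₀ g₀ K) a))).withDensity f).restrict A) U
            (epsOfRecord θ.ν (histA₁₃ θ K₀ g₀ K) (K₀ + K)) (ρA F θ hP g₀ os K) D ∧
          D ≤ DA K)
    (hB : ∀ (K : ℕ) (t : ℝ), |t| ≤ 1 →
      ∀ (a : ↥(cubeIndices (F.P (K₀ + K + 1)) (cubeSide (F.P (K₀ + K + 1)).L θ.ν.M₂ (RkOfRecord (F.P (K₀ + K + 1)).L θ.ν.r (histB₁₃ θ K₀ g₀ K (K₀ + K + 1))) (K₀ + K + 1))))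
        (x : GaugeField (F.P (K₀ + K + 1)) (K₀ + K + 1) (SU N)),
        ∃ (S : ℝ) (c : GaugeField (F.P (K₀ + K + 1)) (K₀ + K + 1) (SU N)) (R : (↥(inputBlock F θ.ν (histB₁₃ θ K₀ g₀ K) a) → SU N) → ℝ≥0∞)
          (U : BlockChartSU N (inputBlock F θ.ν (histB₁₃ θ K₀ g₀ K) a) → ℝ) (A : Set (BlockChartSU N (inputBlock F θ.ν (histB₁₃ θ K₀ g₀ K) a)))
          (f : BlockChartSU N (inputBlock F θ.ν (histB₁₃ θ K₀ g₀ K) a) → ℝ≥0∞) (D : ℝ),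
          0 ≤ S ∧ S ≤ Real.pi ∧ Measurable R ∧
          blockFibreLawOfDatum₉ F N θ.toStage9Params (datumOfRecord₁₃CoPH F N θ hP) g₀ os (runB₁₃ F K₀ g₀ K) (histB₁₃ θ K₀ g₀ K) (K₀ + K + 1) t a (inputBlock F θ.ν (histB₁₃ θ K₀ g₀ K) a) x
            = (blockLaw (inputBlock F θ.ν (histB₁₃ θ K₀ g₀ K) a)).withDensity (fun y => windowSU (inputBlock F θ.ν (histB₁₃ θ K₀ g₀ K) a) c S y * R y) ∧
          MeasurableSet A ∧
          (∀ z ∈ closedBall (0 : BlockChartSU N (inputBlock F θ.ν (histB₁₃ θ K₀ g₀ K) a)) S,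
            blockReading N (cubeStat F N θ.ν (histB₁₃ θ K₀ g₀ K) (Kc := K₀ + K + 1) (k := K₀ + K + 1) a) (inputBlock F θ.ν (histB₁₃ θ K₀ g₀ K) a) (fun _ => 1) (expFibreChartSU (inputBlock F θ.ν (histB₁₃ θ K₀ g₀ K) a) c z) = U z) ∧
          ((fun z : BlockChartSU N (inputBlock F θ.ν (histB₁₃ θ K₀ g₀ K) a) =>
              chartWeightSU (inputBlock F θ.ν (histB₁₃ θ K₀ g₀ K) a) S (expJacWeightSU (kappaSU N)) z * R (expFibreChartSU (inputBlock F θ.ν (histB₁₃ θ K₀ g₀ K) a) c z))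
            =ᵐ[volume] A.indicator f) ∧
          SlotAntiConcentration (((volume : Measure (BlockChartSU N (inputBlock F θ.ν (histB₁₃ θ K₀ g₀ K) a))).withDensity f).restrict A) U
            (epsOfRecord θ.ν (histB₁₃ θ K₀ g₀ K) (K₀ + K + 1)) (ρB F θ hP g₀ os K) D ∧
          D ≤ DB K)
    :
    ShellWeightBound (crOfRecord₁₃VAt K₀ jcut (shellSplitOfRecord₁₃At N K₀ ρA ρB) F θ hP g₀ os).l₀
      (crOfRecord₁₃VAt K₀ jcut (shellSplitOfRecord₁₃At N K₀ ρA ρB) F θ hP g₀ os).T (crOfRecord₁₃VAt K₀ jcut (shellSplitOfRecord₁₃At N K₀ ρA ρB) F θ hP g₀ os).A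
      (crOfRecord₁₃VAt K₀ jcut (shellSplitOfRecord₁₃At N K₀ ρA ρB) F θ hP g₀ os).B (crOfRecord₁₃VAt K₀ jcut (shellSplitOfRecord₁₃At N K₀ ρA ρB) F θ hP g₀ os).shA
      (crOfRecord₁₃VAt K₀ jcut (shellSplitOfRecord₁₃At N K₀ ρA ρB) F θ hP g₀ os).shB (crOfRecord₁₃VAt K₀ jcut (shellSplitOfRecord₁₃At N K₀ ρA ρB) F θ hP g₀ os).Wsh :=
  (shellWeightBound_crOfRecord₁₃VAt_iff_crOfRecord₁₃At K₀ jcut (shellSplitOfRecord₁₃At N K₀ ρA ρB) θ hP g₀ os).mpr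
    (shellWeightBound_crOfRecord₁₃At_shellSplit_of_chartLaws K₀ jcut ρA ρB θ hP g₀ os E hsel hU hζm hζ0 hρA hDA hρB hDB hsA hsB hA hB)

end AtRecord

end Summit.QuantumFields.YangMills.Theorems.N21ChartJunctionKeyed
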